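import Mathlib.Analysis.InnerProductSpace.l2Space
import Mathlib.Analysis.InnerProductSpace.Trace
import Mathlib.Analysis.InnerProductSpace.Projection.Basic
import Mathlib.Analysis.SpecificLimits.Basic
import Mathlib.Topology.Algebra.Module.FiniteDimension
import HarnessLib

/-!
# The local cutoff trace law at a finite place is EXACT at every finite level — PROVED

Topic `Literature/NumberTheory/ConnesConsani` (companion of `AdeleClassTraceFormula.lean`, which types
Connes' 1999 trace formula at statement level and deliberately leaves the cutoff operators `R_Λ` untyped).

## The published objects (read at page)

* Haran [Haran2001, §2 (2.4)_p–(2.7)_p]: for a finite prime `p` and `β > 0` the radial Hilbert space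
  `H_p^β = L₂(ℚ_p, τ_p^β)^{ℤ_p^*} = ℓ₂(p^ℤ, τ_p^β)`, `τ_p^β(p^n) = p^{-nβ}(1 - p^{-β})` ((2.5)_p; `β = 1`
  is the additive Haar measure, (2.4)_p), the UNITARY dilation `π_p^β(p^m) φ(x) = p^{mβ/2} φ(p^{-m} x)`
  with cyclic vector `φ_{ℤ_p}` (the indicator of the ball `p^ℕ ∪ {0}`), and the `(2N+1)`-dimensional
  cutoff space (2.7)_p `H_p^β(N) = {φ : supp φ, supp F_p^β φ ⊆ {|x|_p ≤ p^N}} = ⊕_{|n| ≤ N} ℂ π_p^β(p^n) φ_{ℤ_p}`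
  ("additive" = "multiplicative" characterisation), i.e. the span of the balls `1_{p^n ℤ_p}`, `|n| ≤ N` =
  the span of the shells `1_{p^n ℤ_p^*}`, `-N ≤ n ≤ N-1`, and the ball `1_{p^N ℤ_p}`; [Haran2001, §3 (3.3)]
  `B_{p^N} B̂_{p^N} H_p = H_p(N)` (Connes' cutoff `R_Λ = P̂_Λ P_Λ` at one finite place, [Connes1999, V (15)–(16)]).
* van Frankenhuijsen [Frankenhuijsen2014, §6.3, the display closing p. 96]: at a finite place `v` of a
  function field the trace of the shift operator compressed to the cutoff space is EXACTLY
  `tr(E_v 𝓕_v M_θ 𝓕_v⁻¹ A_v M_Ω U_h) = (θ + ω + 1 - k_v) h(1) + W_v(h)`, the local Weil term being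
  `W_v(h) = Σ_{n ≠ 1} min{1, |n|_v} |n|_v^{-1/2} h(n)` (loc. cit., via Lemma 6.3.3), i.e. the shift by a
  uniformiser power `ϖ^m`, `m ≠ 0`, contributes `q_v^{-|m|/2}` and `m = 0` contributes the dimension.
* Connes [Connes1999, Thm V.3]: for a general local field and cutoff, `Trace(R_Λ U(h)) = 2h(1) log′Λ +
  ∫′ h(u⁻¹)/|1-u| d*u + o(1)` — asymptotic; at a finite place with the lattice-adapted cutoff above the
  `o(1)` is absent, which is what this file proves.

## What is proved here (the finite-level law, all parameters)

Under the isometry `ℓ₂(p^ℤ, τ_p^β) ≅ ℓ²(ℤ)`, `1_{p^n ℤ_p^*} ↦ τ_p^β(p^n)^{1/2} e_n`, the dilation `π_p^β(p^m)`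
becomes the bilateral SHIFT `S^m e_n = e_{n+m}` (`π(p^m) 1_{S_n} = p^{mβ/2} 1_{S_{n+m}}` and
`τ(p^{n+m})^{1/2} = p^{-mβ/2} τ(p^n)^{1/2}`), and the ball `1_{p^a ℤ_p} = Σ_{n ≥ a} 1_{S_n}` becomes a positive
multiple of `β_a = Σ_{n ≥ a} r^{n-a} e_n` with `r = p^{-β/2} ∈ [0,1)` (`ballVec`).  For ANY finite set `F`
of shell indices below `a` the cutoff space `V = span{e_n : n ∈ F} ⊕ ℝ β_a` (`cutoffSpace`; Haran's
`H_p^β(N)` is `F = [-N, N-1]`, `a = N`) satisfies (`trace_compression_shift_cutoffSpace`)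

  `tr(P_V S^m |_V) = #F · [m = 0] + r^{|m|}`,

so for Haran's window `tr = 2N + 1` at `m = 0` and `= p^{-β|m|/2}` at `m ≠ 0`
(`trace_compression_shift_haranWindow`): each shell contributes `[m = 0]`, the ball contributes
`⟪β_a, S^m β_a⟫/‖β_a‖² = r^{|m|}` (a ratio of two geometric series).  The abstract input is the
compression-trace formula `tr(P_K T|_K) = Σ_i ⟪u_i, T u_i⟫` for the span `K` of a finite orthonormal
family (`trace_compression_span_eq_sum_inner`, [folklore]).  Everything is over `ℝ` (the law is real) and
sorry-free; no named facts.

USED BY the RH-door construction census (run/shared/lean/pub/pub-rhdoor/census): the `(i)`-side words of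
the items `t2-connes-local-cutoff-01`, `t1-connes-local-cutoff-ctlpos` (`β = 1`), `t1-haran-beta-local-
cutoff-01` (`r = p^{-β/2}`, `β ∈ {2,3}`) and `t2-vf-local-shift-01` (`r = q_v^{-1/2}`) are instances of this
one theorem for all `(p, β, N, m)` — "construction census at finite level; no RH claim".

## Deliberately NOT here
The identification `L₂(ℚ_p)^{ℤ_p^*} ≅ ℓ²(ℤ)` itself (Mathlib has no normalised Haar measure on `ℚ_p` with
`vol(p^n ℤ_p) = p^{-n}` packaged for this), the Fourier-side description (2.7)_p "additive" / (2.8)_p, the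
archimedean place (2.7)_η (prolate functions), and any `Λ → ∞` statement.
-/

noncomputable section

open scoped InnerProductSpace
open Submodule

namespace Literature.NumberTheory.ConnesConsani

/-! ## 1. Compression of an operator to a subspace and its trace on the span of an orthonormal family -/

section Compression

variable {E : Type*} [NormedAddCommGroup E] [InnerProductSpace ℝ E]

/-- The COMPRESSION `P_K T|_K : K → K` of a linear operator `T` to a subspace `K` admitting an
orthogonal projection `P_K` (`x ↦ P_K (T x)`). [folklore] -/
def compression (K : Submodule ℝ E) [K.HasOrthogonalProjection] (T : E →ₗ[ℝ] E) : K →ₗ[ℝ] K :=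
  K.orthogonalProjectionOnto.toLinearMap ∘ₗ T ∘ₗ K.subtype

/-- Unfolding lemma: `compression K T x = P_K (T x)`. [folklore] -/
private theorem compression_apply (K : Submodule ℝ E) [K.HasOrthogonalProjection] (T : E →ₗ[ℝ] E) (x : K) :
    compression K T x = K.orthogonalProjectionOnto (T (x : E)) := rfl

/-- **Trace of a compression.** For a finite ORTHONORMAL family `u` spanning `K`, the trace of the
compression `P_K T|_K` is `Σ_i ⟪u_i, T u_i⟫` (the diagonal of `T` in the basis `u`; the projection
disappears because `⟪u_i, P_K y⟫ = ⟪u_i, y⟫` for `u_i ∈ K`). [folklore] -/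
private theorem trace_compression_span_eq_sum_inner {ι : Type*} [Fintype ι] {u : ι → E}
    (hu : Orthonormal ℝ u) [(span ℝ (Set.range u)).HasOrthogonalProjection] (T : E →ₗ[ℝ] E) :
    LinearMap.trace ℝ _ (compression (span ℝ (Set.range u)) T) = ∑ i, ⟪u i, T (u i)⟫_ℝ := by
  classical
  let e₀ : Module.Basis ι ℝ (span ℝ (Set.range u)) := Module.Basis.span hu.linearIndependent
  have he₀ : ∀ i, (e₀ i : E) = u i := fun i => by
    simp [e₀, Module.Basis.span_apply]
  have hon : Orthonormal ℝ (⇑e₀) := by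
    rw [orthonormal_iff_ite]
    intro i j
    rw [Submodule.coe_inner, he₀, he₀]
    exact orthonormal_iff_ite.mp hu i j
  let B : OrthonormalBasis ι ℝ (span ℝ (Set.range u)) := OrthonormalBasis.mk hon e₀.span_eq.ge
  have hB : ∀ i, (B i : E) = u i := by
    intro i
    have : B i = e₀ i := by rw [OrthonormalBasis.coe_mk]
    rw [this, he₀]
  rw [LinearMap.trace_eq_sum_inner _ B]
  refine Finset.sum_congr rfl fun i _ => ?_
  rw [compression_apply, Submodule.inner_orthogonalProjectionOnto_eq_of_mem_left, hB]

end Compression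

/-! ## 2. The model `ℓ²(ℤ)`: basis vectors, the bilateral shift, the ball vector -/

/-- The real Hilbert space `ℓ²(ℤ)` — the isometric image of Haran's `ℓ₂(p^ℤ, τ_p^β)` under
`1_{p^n ℤ_p^*} ↦ τ_p^β(p^n)^{1/2} e_n`. [cite: Haran2001, §2 (2.5)_p] -/
abbrev l2Z : Type := lp (fun _ : ℤ => ℝ) 2

namespace LocalCutoff

/-- The basis vector `e_n` of `ℓ²(ℤ)` (image of the normalised shell indicator `1_{p^n ℤ_p^*}`). [folklore] -/
def e (n : ℤ) : l2Z := lp.single 2 n (1 : ℝ)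

/-- Coordinates of `e_n`. [folklore] -/
@[simp] private theorem e_apply (n k : ℤ) : (e n : ℤ → ℝ) k = if k = n then 1 else 0 := by
  classical
  rw [e, lp.single_apply, Pi.single_apply]

/-- Square-summability is invariant under the shift of the index by `m`. [folklore] -/
private theorem memℓp_shift (m : ℤ) (f : l2Z) : Memℓp (fun n : ℤ => (f : ℤ → ℝ) (n - m)) 2 := by
  have hf := lp.memℓp f
  rw [memℓp_gen_iff (by norm_num)] at hf ⊢
  exact (Equiv.subRight m).summable_iff.mpr hf

/-- The bilateral SHIFT `S^m` on `ℓ²(ℤ)`, `(S^m f)(n) = f(n - m)`, i.e. `S^m e_n = e_{n+m}` — the image of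
Haran's unitary dilation `π_p^β(p^m) φ(x) = p^{mβ/2} φ(p^{-m} x)`. [cite: Haran2001, §2 (2.6)_p] -/
def shift (m : ℤ) : l2Z →ₗ[ℝ] l2Z where
  toFun f := ⟨fun n => (f : ℤ → ℝ) (n - m), memℓp_shift m f⟩
  map_add' f g := by
    ext n
    rfl
  map_smul' c f := by
    ext n
    rfl

/-- Coordinates of `S^m f`. [folklore] -/
@[simp] private theorem shift_apply (m : ℤ) (f : l2Z) (n : ℤ) : (shift m f : ℤ → ℝ) n = (f : ℤ → ℝ) (n - m) :=
  rfl

/-- `S^m e_n = e_{n+m}`. [folklore] -/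
private theorem shift_e (m n : ℤ) : shift m (e n) = e (n + m) := by
  ext k
  simp only [shift_apply, e_apply]
  by_cases h : k = n + m
  · rw [if_pos (by omega), if_pos h]
  · rw [if_neg (by omega), if_neg h]

/-- The inner product of `ℓ²(ℤ)` written as a sum of products of coordinates. [folklore] -/
private theorem inner_eq_tsum_mul (f g : l2Z) : ⟪f, g⟫_ℝ = ∑' n, (f : ℤ → ℝ) n * (g : ℤ → ℝ) n := by
  rw [lp.inner_eq_tsum]
  refine tsum_congr fun n => ?_
  simp [mul_comm]

/-- The shift is UNITARY (an isometry of `ℓ²(ℤ)` onto itself): `⟪S^m f, S^m g⟫ = ⟪f, g⟫` — Haran's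
"unitary action `π_p^β` of `p^ℤ` on `H_p^β`" in the isometric picture. [cite: Haran2001, §2 (2.6)_p] -/
theorem inner_shift_shift (m : ℤ) (f g : l2Z) : ⟪shift m f, shift m g⟫_ℝ = ⟪f, g⟫_ℝ := by
  rw [inner_eq_tsum_mul, inner_eq_tsum_mul]
  exact (Equiv.subRight m).tsum_eq (fun n => (f : ℤ → ℝ) n * (g : ℤ → ℝ) n)

/-- `⟪e_n, S^m e_n⟫ = [m = 0]`: a shell contributes to the trace only at `m = 0`. [folklore] -/
private theorem inner_e_shift_e (m n : ℤ) : ⟪e n, shift m (e n)⟫_ℝ = if m = 0 then 1 else 0 := by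
  classical
  rw [shift_e, e, e, lp.inner_single_left, lp.single_apply, Pi.single_apply]
  by_cases h : m = 0
  · subst h; simp
  · rw [if_neg (by omega), if_neg h]; simp

section Ball

variable (r : ℝ) (hr : 0 ≤ r ∧ r < 1) (a : ℤ)

/-- Coordinates of the BALL VECTOR `β_a`: `r^{n-a}` on shells `n ≥ a`, `0` below. [folklore] -/
def ballFun (n : ℤ) : ℝ := if a ≤ n then r ^ (n - a).toNat else 0

/-- On the shell `a + j` the ball vector has coordinate `r^j`. [folklore] -/
private theorem ballFun_apply_add (j : ℕ) : ballFun r a (a + j) = r ^ j := by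
  simp [ballFun]

/-- Below the ball the coordinates vanish. [folklore] -/
private theorem ballFun_eq_zero_of_lt {n : ℤ} (h : n < a) : ballFun r a n = 0 := by
  simp [ballFun, not_le.mpr h]

include hr in
/-- `Σ_{n ≥ a} r^{2(n-a)} < ∞`: the ball vector is square-summable for `0 ≤ r < 1`. [folklore] -/
private theorem memℓp_ballFun : Memℓp (ballFun r a) 2 := by
  rw [memℓp_gen_iff (by norm_num)]
  have hg : Function.Injective (fun j : ℕ => a + (j : ℤ)) := fun j k h => by
    simpa using h
  have h0 : ∀ n ∉ Set.range (fun j : ℕ => a + (j : ℤ)), ‖ballFun r a n‖ ^ (2 : ENNReal).toReal = 0 := by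
    intro n hn
    have : n < a := by
      by_contra hna
      exact hn ⟨(n - a).toNat, by simp; omega⟩
    simp [ballFun_eq_zero_of_lt r a this]
  refine (hg.summable_iff h0).mp ?_
  have : ((fun n : ℤ => ‖ballFun r a n‖ ^ (2 : ENNReal).toReal) ∘ fun j : ℕ => a + (j : ℤ)) =
      fun j : ℕ => (r ^ 2) ^ j := by
    funext j
    simp only [Function.comp_apply, ENNReal.toReal_ofNat, ballFun_apply_add, Real.norm_eq_abs,
      Real.rpow_two]
    rw [abs_of_nonneg (pow_nonneg hr.1 _), ← pow_mul, mul_comm, pow_mul]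
  rw [this]
  exact summable_geometric_of_lt_one (sq_nonneg r) (by nlinarith [hr.1, hr.2])

/-- The BALL VECTOR `β_a = Σ_{n ≥ a} r^{n-a} e_n ∈ ℓ²(ℤ)`: up to the positive factor
`τ_p^β(p^a ℤ_p^*)^{1/2}` it is the isometric image of Haran's cyclic ball indicator `π(p^a) φ_{ℤ_p} =
1_{p^a ℤ_p} = Σ_{n ≥ a} 1_{p^n ℤ_p^*}`, with `r = p^{-β/2}`. [cite: Haran2001, §2 (2.7)_p] -/
def ballVec : l2Z := ⟨ballFun r a, memℓp_ballFun r hr a⟩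

/-- Coordinates of `β_a`. [folklore] -/
@[simp] private theorem ballVec_apply (n : ℤ) : (ballVec r hr a : ℤ → ℝ) n = ballFun r a n := rfl

include hr in
/-- The key computation: `⟪β_a, S^m β_a⟫ = r^{|m|} (1 - r²)⁻¹` — only shells `n ≥ a + max(0,m)` meet,
and there the summand is `r^{|m|} (r²)^j`. [folklore] -/
private theorem inner_ballVec_shift_ballVec (m : ℤ) :
    ⟪ballVec r hr a, shift m (ballVec r hr a)⟫_ℝ = r ^ m.natAbs * (1 - r ^ 2)⁻¹ := by
  rw [inner_eq_tsum_mul]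
  simp only [ballVec_apply, shift_apply]
  -- reindex the sum over its support `{n ≥ a + m⁺}` by `j ↦ a + m⁺ + j`
  set c : ℤ := a + (m.toNat : ℤ) with hc
  have hg : Function.Injective (fun j : ℕ => c + (j : ℤ)) := fun j k h => by simpa using h
  have hsupp : Function.support (fun n : ℤ => ballFun r a n * ballFun r a (n - m)) ⊆
      Set.range (fun j : ℕ => c + (j : ℤ)) := by
    intro n hn
    rw [Function.mem_support] at hn
    have h1 : a ≤ n := by
      by_contra h; exact hn (by rw [ballFun_eq_zero_of_lt r a (not_le.mp h), zero_mul])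
    have h2 : a ≤ n - m := by
      by_contra h; exact hn (by rw [ballFun_eq_zero_of_lt r a (not_le.mp h), mul_zero])
    refine ⟨(n - c).toNat, ?_⟩
    simp only [hc]
    omega
  rw [← hg.tsum_eq hsupp]
  have hterm : ∀ j : ℕ, ballFun r a (c + (j : ℤ)) * ballFun r a (c + (j : ℤ) - m) =
      r ^ m.natAbs * (r ^ 2) ^ j := by
    intro j
    have e1 : c + (j : ℤ) = a + ((m.toNat + j : ℕ) : ℤ) := by simp [hc]; ring
    have e2 : a + ((m.toNat + j : ℕ) : ℤ) - m = a + (((-m).toNat + j : ℕ) : ℤ) := by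
      push_cast
      omega
    rw [e1, ballFun_apply_add, e2, ballFun_apply_add, ← pow_add,
      show m.toNat + j + ((-m).toNat + j) = m.natAbs + 2 * j by omega, pow_add, pow_mul]
  simp_rw [hterm]
  rw [tsum_mul_left, tsum_geometric_of_lt_one (sq_nonneg r) (by nlinarith [hr.1, hr.2])]

include hr in
/-- `‖β_a‖² = (1 - r²)⁻¹`. [folklore] -/
private theorem inner_ballVec_self : ⟪ballVec r hr a, ballVec r hr a⟫_ℝ = (1 - r ^ 2)⁻¹ := by
  have h := inner_ballVec_shift_ballVec r hr a 0
  have h0 : shift 0 (ballVec r hr a) = ballVec r hr a := by ext n; simp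
  rw [h0] at h
  simpa using h

/-- `⟪e_n, β_a⟫ = 0` for a shell `n < a` below the ball. [folklore] -/
private theorem inner_e_ballVec {n : ℤ} (hn : n < a) : ⟪e n, ballVec r hr a⟫_ℝ = 0 := by
  classical
  rw [e, lp.inner_single_left, ballVec_apply, ballFun_eq_zero_of_lt r a hn]
  simp

/-- `⟪β_a, e_n⟫ = 0` for a shell `n < a` below the ball. [folklore] -/
private theorem inner_ballVec_e {n : ℤ} (hn : n < a) : ⟪ballVec r hr a, e n⟫_ℝ = 0 := by
  rw [real_inner_comm]
  exact inner_e_ballVec r hr a hn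

end Ball

/-! ## 3. The cutoff space and the exact trace law -/

section Cutoff

variable (r : ℝ) (hr : 0 ≤ r ∧ r < 1) (a : ℤ) (F : Finset ℤ)

/-- The orthonormal frame of the cutoff space: the shells `e_n`, `n ∈ F`, and the normalised ball
vector `(1 - r²)^{1/2} β_a`. [folklore] -/
def frame : Option F → l2Z
  | none => Real.sqrt (1 - r ^ 2) • ballVec r hr a
  | some n => e (n : ℤ)

/-- The CUTOFF SPACE `V = span{e_n : n ∈ F} ⊕ ℝ β_a` — for `F = [-N, N-1]`, `a = N` the isometric image of
Haran's `(2N+1)`-dimensional `H_p^β(N) = ⊕_{|n| ≤ N} ℂ π_p^β(p^n) φ_{ℤ_p} = B_{p^N} B̂_{p^N} H_p^β`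
(real form). [cite: Haran2001, §2 (2.7)_p and §3 (3.3)] -/
abbrev cutoffSpace : Submodule ℝ l2Z := span ℝ (Set.range (frame r hr a F))

include hr in
/-- For shells strictly below the ball the frame is ORTHONORMAL. [folklore] -/
private theorem orthonormal_frame (hF : ∀ n ∈ F, n < a) : Orthonormal ℝ (frame r hr a F) := by
  classical
  have hr2 : 0 < 1 - r ^ 2 := by nlinarith [hr.1, hr.2]
  rw [orthonormal_iff_ite]
  rintro (_ | ⟨n, hn⟩) (_ | ⟨k, hk⟩)
  · -- ball / ball
    simp only [frame, real_inner_smul_left, real_inner_smul_right, inner_ballVec_self r hr a]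
    rw [← mul_assoc, ← Real.sqrt_mul hr2.le, Real.sqrt_mul_self hr2.le, mul_inv_cancel₀ hr2.ne']
    simp
  · -- ball / shell
    simp only [frame, real_inner_smul_left, inner_ballVec_e r hr a (hF k hk), mul_zero]
    simp
  · -- shell / ball
    simp only [frame, real_inner_smul_right, inner_e_ballVec r hr a (hF n hn), mul_zero]
    simp
  · -- shell / shell
    simp only [frame, e, lp.inner_single_left, lp.single_apply, Pi.single_apply, Option.some.injEq,
      Subtype.mk.injEq]
    by_cases h : n = k <;> simp [h]

/-- The cutoff space is finite-dimensional (spanned by `#F + 1` vectors). [folklore] -/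
instance cutoffSpace.instFiniteDimensional : FiniteDimensional ℝ (cutoffSpace r hr a F) :=
  FiniteDimensional.span_of_finite ℝ (Set.finite_range _)

/-- Hence complete, so that Mathlib's orthogonal projection onto it exists
(`Submodule.HasOrthogonalProjection.ofCompleteSpace`). [folklore] -/
instance cutoffSpace.instCompleteSpace : CompleteSpace (cutoffSpace r hr a F) :=
  FiniteDimensional.complete ℝ _

/-- **The local cutoff trace law, exact at every finite level.**  On the cutoff space `V` spanned by the
shells `e_n`, `n ∈ F` (all below `a`), and the ball vector `β_a`, the compression of the shift `S^m` has
trace `#F · [m = 0] + r^{|m|}`: every shell contributes `[m = 0]`, the ball contributes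
`⟪β_a, S^m β_a⟫ / ‖β_a‖² = r^{|m|}`.  With `r = p^{-β/2}` this is the census law
`Tr(Π_a π^β(p^m) Π_a) = dim · [m = 0] + p^{-β|m|/2}` for ALL `(p, β, a, F, m)`; van Frankenhuijsen's
`(θ + ω + 1 - k_v) h(1) + W_v(h)` at a finite place of a function field (`r = q_v^{-1/2}`).
[cite: Frankenhuijsen2014, §6.3 (display p. 96) and Lemma 6.3.3] -/
theorem trace_compression_shift_cutoffSpace (hF : ∀ n ∈ F, n < a) (m : ℤ) :
    LinearMap.trace ℝ _ (compression (cutoffSpace r hr a F) (shift m)) =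
      (if m = 0 then (F.card : ℝ) else 0) + r ^ m.natAbs := by
  classical
  have hr2 : 0 < 1 - r ^ 2 := by nlinarith [hr.1, hr.2]
  rw [trace_compression_span_eq_sum_inner (orthonormal_frame r hr a F hF), Fintype.sum_option, add_comm]
  congr 1
  · -- the shells
    have : ∀ i : F, ⟪frame r hr a F (some i), shift m (frame r hr a F (some i))⟫_ℝ =
        if m = 0 then 1 else 0 := fun i => inner_e_shift_e m i
    simp only [this, Finset.sum_const, Finset.card_univ, Fintype.card_coe, nsmul_eq_mul]
    split_ifs <;> simp
  · -- the ball
    simp only [frame, map_smul, real_inner_smul_left, real_inner_smul_right,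
      inner_ballVec_shift_ballVec r hr a m]
    rw [← mul_assoc, ← Real.sqrt_mul hr2.le, Real.sqrt_mul_self hr2.le, mul_comm (r ^ m.natAbs),
      ← mul_assoc, mul_inv_cancel₀ hr2.ne', one_mul]

/-- The law is EVEN in `m`: the local term weights `p^{-|n|/2}` are symmetric under `n ↦ -n`
(time reversal), as in the printed local formula. [cite: Haran2001, §2 (2.12)_p] -/
theorem trace_compression_shift_cutoffSpace_neg (hF : ∀ n ∈ F, n < a) (m : ℤ) :
    LinearMap.trace ℝ _ (compression (cutoffSpace r hr a F) (shift (-m))) =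
      LinearMap.trace ℝ _ (compression (cutoffSpace r hr a F) (shift m)) := by
  rw [trace_compression_shift_cutoffSpace r hr a F hF, trace_compression_shift_cutoffSpace r hr a F hF]
  simp

/-- HARAN'S WINDOW `H_p^β(N)`: shells `-N ≤ n ≤ N-1` and the ball `1_{p^N ℤ_p}` (`F = [-N, N-1]`,
`a = N`, dimension `2N + 1`): `tr(P S^m P) = 2N + 1` for `m = 0` and `= r^{|m|} = p^{-β|m|/2}` for
`m ≠ 0` — the census items `t2-connes-local-cutoff-01` / `t1-connes-local-cutoff-ctlpos` (`β = 1`) and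
`t1-haran-beta-local-cutoff-01` (`β = 2, 3`), for every `(p, β, N, m)`.
[cite: Haran2001, §2 (2.7)_p] -/
theorem trace_compression_shift_haranWindow (N : ℕ) (m : ℤ) :
    LinearMap.trace ℝ _
        (compression (cutoffSpace r hr (N : ℤ) (Finset.Ico (-(N : ℤ)) N)) (shift m)) =
      if m = 0 then (2 * N + 1 : ℝ) else r ^ m.natAbs := by
  rw [trace_compression_shift_cutoffSpace r hr (N : ℤ) _ (fun n hn => (Finset.mem_Ico.mp hn).2) m,
    Int.card_Ico]
  split_ifs with h
  · subst h
    have : ((N : ℤ) - -(N : ℤ)).toNat = 2 * N := by omega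
    rw [this]; push_cast; ring
  · simp

end Cutoff

/-!
## 4.–7. Van Frankenhuijsen's printed form (appended): the combined shift `U_h` and the Weil
## distribution `W_v(h)` (formula (6.10)), the printed action of the cut-off `E_v C_{𝓕_v θ} A_v M_Ω` on
## the basis `δ_m`, and the window `-ω ≤ m < θ - k_v` of (6.7)–(6.9) — all PROVED, no named facts

Source, read at page: [Frankenhuijsen2014, §6.3 "The local trace", §6.3.2 "Direct computation", formulas
(6.7)–(6.10), and §6.4 (first paragraph)].  At ONE place `v` of a function field (`q_v = q^{deg v}`, `k_v`
the coefficient of the canonical divisor, cut-off degrees `ω, θ` with **(6.7)** `ω + θ ≥ k_v`), on the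
space of degrees `ℓ²(K_v^*/𝔬_v^*) = ℓ²(ℤ)` with orthonormal basis `δ_n = 1_{v(x) = n}` and shift
`U(a) δ_n = δ_{n+l}`, `a = π_v^l`, the book COMPUTES the cut-off `P = E_v C_{𝓕_v θ} A_v M_Ω` on the basis
(§6.3.2, the display preceding (6.8), "where Q is the factor `q_v^{θ-k_v-m/2}(1-q_v^{-1})`"):

  `P δ_m = 0` for `m < -ω`;  `P δ_m = δ_m` for `-ω ≤ m < θ - k_v`;
  `P δ_m = Q √|·|_v 𝔭_v^{θ-k_v}`, `Q = q_v^{θ-k_v-m/2} (1 - q_v^{-1})`, for `m ≥ θ - k_v`,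

checks that `P` is an orthogonal projection (§6.4: "From its kernel, we see that P is self-adjoint … we
conclude that `P² = P`"), and proves **(6.8)** `tr(P U(a)) = min{|a|_v^{1/2}, |a|_v^{-1/2}}`
(`a ∉ 𝔬_v^*`), **(6.9)** `tr(P U(a)) = θ + ω - k_v + 1` (`a ∈ 𝔬_v^*`), and **(6.10)**
`tr(P U_h) = (θ + ω + 1 - k_v) h(1) + W_v(h)` for the combined shift `U_h = Σ_{n ∈ K_v^*/𝔬_v^*} h(n) U(n)`,
"where `W_v(h)` is the Weil distribution as given in (4.5)", `W_v(h) = Σ_{n ≠ 0} q_v^{-|n|/2} h(π_v^n)`.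

What §§4–7 add to §§1–3 (parameter `r = q_v^{-1/2}`, shells `F`, ball at `a`; then `F = [-ω, θ - k_v)`,
`a = θ - k_v`):
* §4 `compressedTrace` (the compressed trace is LINEAR in the operator), `combinedShift h = Σ_l h(l) S^l`
  (`h : ℤ →₀ ℝ`), `weilLocalTerm r h = Σ_{l ≠ 0} r^{|l|} h(l)`; `trace_compression_combinedShift_cutoffSpace`:
  `tr(P_V U_h|_V) = (#F + 1) h(0) + W(h)` — (6.10) for every cutoff space of §3 (Haran's windows
  included); `finrank_cutoffSpace`: `dim V = #F + 1` (the law at `m = 0`: the compression of `S^0` is `1_V`).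
* §5 the PRINTED ACTION of the cut-off = Mathlib's orthogonal projection `(cutoffSpace …).starProjection`
  on the basis: `starProjection_e_of_mem` (`δ_m ↦ δ_m`, kept shells), `starProjection_e_of_lt_of_not_mem`
  (`δ_m ↦ 0`, shells cut away), `starProjection_e_of_le` (`δ_m ↦ (1 - r²) r^{m-a} β_a` at and beyond the
  ball — the third printed case, since `√|·|_v 𝔭_v^{a} = (n ↦ q_v^{-n/2})_{n ≥ a} = r^{a} β_a` and
  `Q q_v^{-n/2} = (1 - r²) r^{m-a} r^{n-a}`).  So the finite-level object "range `P` = span{δ_{-ω..θ-k_v-1}}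
  ⊕ ℝ ξ, `P δ_m = ⟪ξ, δ_m⟫ ξ/‖ξ‖²`" of finite-level implementations IS the printed operator.
* §6 the book's window: `vfShells ω θ k = [-ω, θ - k)`, `vfCutoffSpace`; with (6.7) as the hypothesis
  `k ≤ ω + θ`: `trace_vfCutoff_shift_of_ne_zero` (6.8) `= r^{|l|}`, `trace_vfCutoff_shift_zero` (6.9)
  `= θ + ω - k + 1`, `finrank_vfCutoffSpace`, `trace_vfCutoff_combinedShift` (6.10)
  `= (θ + ω + 1 - k) h(0) + W_v(h)` with the printed constants, and the three printed cases
  `starProjection_vfCutoff_e_of_lt / _of_mem / _of_le`.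
* §7 `min_zpow_neg_zpow_eq`: `min{s^{-l}, s^{l}} = (s⁻¹)^{|l|}` (`s = q_v^{1/2} ≥ 1`), i.e. the printed
  right-hand side of (6.8) `min{|a|_v^{1/2}, |a|_v^{-1/2}} = q_v^{-|l|/2} = r^{|l|}` for `|a|_v = q_v^{-l}`.

USED BY the census (as above): reader row `t1-r1-002` (its description of the range and action of `P_v`)
and the `(i)`-trace words of `t2-vf-local-shift-01` / `t1-connes-local-cutoff-ctlpos` in the
Weil-distribution form (6.10).  Deliberately NOT here: the operators `E_v`, `A_v`, `M_Ω`,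
`C_{𝓕_v θ} = 𝓕_v M_θ 𝓕_v^{-1}` on functions on `K_v` themselves (Lemma 6.3.2 / Thm 2.1.15 need local
Fourier analysis on `K_v`) — §5 starts, as the census does, from their computed action on the basis; the
kernel computation §6.3.3; the semi-local case `|S| ≥ 2` (§6.5–6.7, where the book shows the trace does
NOT reproduce the explicit formula); the global positivity argument of §6.4.
-/

/-! ## 4. Linearity of the compressed trace; the combined shift `U_h` and formula (6.10) -/

section Combined

variable (r : ℝ) (hr : 0 ≤ r ∧ r < 1) (a : ℤ) (F : Finset ℤ)

/-- The compressed trace `T ↦ tr(P_K T|_K)` as a LINEAR functional of the operator `T`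
(`compression K T = P_K ∘ T ∘ ι_K` is linear in `T`). [folklore] -/
def compressedTrace {E : Type*} [NormedAddCommGroup E] [InnerProductSpace ℝ E] (K : Submodule ℝ E)
    [K.HasOrthogonalProjection] [FiniteDimensional ℝ K] : (E →ₗ[ℝ] E) →ₗ[ℝ] ℝ where
  toFun T := LinearMap.trace ℝ K (compression K T)
  map_add' S T := by
    rw [← map_add]
    congr 1
    simp only [compression, LinearMap.add_comp, LinearMap.comp_add]
  map_smul' c T := by
    rw [RingHom.id_apply, ← map_smul]
    congr 1
    simp only [compression, LinearMap.smul_comp, LinearMap.comp_smul]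

/-- Unfolding lemma. [folklore] -/
private theorem compressedTrace_apply {E : Type*} [NormedAddCommGroup E] [InnerProductSpace ℝ E]
    (K : Submodule ℝ E) [K.HasOrthogonalProjection] [FiniteDimensional ℝ K] (T : E →ₗ[ℝ] E) :
    compressedTrace K T = LinearMap.trace ℝ K (compression K T) := rfl

/-- The COMBINED SHIFT `U_h = Σ_{n ∈ K_v^*/𝔬_v^*} h(n) U(n)` of a finitely supported test function `h`
on the value group `K_v^*/𝔬_v^* ≅ ℤ` (`h l` is the value of `h` at `π_v^l`; `U(π_v^l) = S^l` the shift
`δ_n ↦ δ_{n+l}`). [cite: Frankenhuijsen2014, §6.3.2 (6.10)] -/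
def combinedShift (h : ℤ →₀ ℝ) : l2Z →ₗ[ℝ] l2Z :=
  h.sum fun l c => c • shift l

/-- The local WEIL DISTRIBUTION `W_v(h) = Σ_{n ≠ 0} q_v^{-|n|/2} h(π_v^n)` of (4.5), written with
`r = q_v^{-1/2}`: `Σ_{n ≠ 0} r^{|n|} h(n)`. [cite: Frankenhuijsen2014, §4.3 (4.5)] -/
def weilLocalTerm (r : ℝ) (h : ℤ →₀ ℝ) : ℝ :=
  h.sum fun l c => if l = 0 then 0 else r ^ l.natAbs * c

include hr in
/-- **(6.10), general cutoff space.** On `V = span{e_n : n ∈ F} ⊕ ℝ β_a` (shells `F` below the ball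
`a`), the compressed trace of the combined shift is `tr(P_V U_h|_V) = (#F + 1) h(1) + W_v(h)`:
the dimension times `h` at the identity plus the Weil distribution — by linearity from the monomial
law `trace_compression_shift_cutoffSpace`. [cite: Frankenhuijsen2014, §6.3.2 (6.10)] -/
theorem trace_compression_combinedShift_cutoffSpace (hF : ∀ n ∈ F, n < a) (h : ℤ →₀ ℝ) :
    LinearMap.trace ℝ _ (compression (cutoffSpace r hr a F) (combinedShift h)) =
      ((F.card : ℝ) + 1) * h 0 + weilLocalTerm r h := by
  classical
  rw [← compressedTrace_apply, combinedShift, map_finsuppSum]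
  simp only [map_smul, compressedTrace_apply, trace_compression_shift_cutoffSpace r hr a F hF,
    smul_eq_mul]
  rw [weilLocalTerm, Finsupp.sum, Finsupp.sum]
  have key : ∀ l ∈ h.support,
      h l * ((if l = 0 then (F.card : ℝ) else 0) + r ^ l.natAbs) =
        (if l = 0 then ((F.card : ℝ) + 1) * h l else 0) +
          (if l = 0 then 0 else r ^ l.natAbs * h l) := by
    intro l _
    split_ifs with hl
    · subst hl; simp; ring
    · ring
  rw [Finset.sum_congr rfl key, Finset.sum_add_distrib, Finset.sum_ite_eq']
  congr 1
  split_ifs with h0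
  · rfl
  · have : h 0 = 0 := by simpa [Finsupp.mem_support_iff] using h0
    rw [this, mul_zero]

include hr in
/-- The DIMENSION of the cutoff space is `#F + 1` — the value (6.9) of the trace at `a ∈ 𝔬_v^*`, since
the compression of `U(1) = S^0 = 1` is the identity of `V` (Haran's `dim H_p^β(N) = 2N + 1` for
`F = [-N, N-1]`). [cite: Frankenhuijsen2014, §6.3.2 (6.9)] -/
theorem finrank_cutoffSpace (hF : ∀ n ∈ F, n < a) :
    (Module.finrank ℝ (cutoffSpace r hr a F) : ℝ) = F.card + 1 := by
  have hid : compression (cutoffSpace r hr a F) (shift 0) = LinearMap.id := by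
    apply LinearMap.ext
    intro x
    have h0 : shift 0 (x : l2Z) = x := by
      ext n
      rw [shift_apply, sub_zero]
    rw [compression, LinearMap.comp_apply, LinearMap.comp_apply, Submodule.subtype_apply,
      h0, ContinuousLinearMap.coe_coe, orthogonalProjectionOnto_mem_subspace_eq_self,
      LinearMap.id_apply]
  have := trace_compression_shift_cutoffSpace r hr a F hF 0
  rw [hid, LinearMap.trace_id, if_pos rfl, Int.natAbs_zero, pow_zero] at this
  exact this

end Combined

/-! ## 5. The printed action of the cut-off on the basis vectors (van Frankenhuijsen §6.3.2) -/

section PrintedAction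

variable (r : ℝ) (hr : 0 ≤ r ∧ r < 1) (a : ℤ) (F : Finset ℤ)

/-- `⟪e_n, f⟫ = f(n)`. [folklore] -/
private theorem inner_e_left (n : ℤ) (f : l2Z) : ⟪e n, f⟫_ℝ = (f : ℤ → ℝ) n := by
  classical
  rw [e, lp.inner_single_left]
  simp

/-- A vector orthogonal to every member of a family is orthogonal to its span. [folklore] -/
private theorem mem_orthogonal_span_range {ι : Type*} {u : ι → l2Z} {w : l2Z}
    (H : ∀ i, ⟪u i, w⟫_ℝ = 0) : w ∈ (span ℝ (Set.range u))ᗮ := by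
  have h : span ℝ {w} ⟂ span ℝ (Set.range u) := by
    rw [isOrtho_span]
    rintro x hx _ ⟨i, rfl⟩
    rw [Set.mem_singleton_iff.1 hx, real_inner_comm]
    exact H i
  exact h.le (subset_span rfl)

include hr in
/-- The ball vector lies in the cutoff space (it is a positive multiple of the frame vector
`(1 - r²)^{1/2} β_a`). [folklore] -/
private theorem ballVec_mem_cutoffSpace : ballVec r hr a ∈ cutoffSpace r hr a F := by
  have hc : Real.sqrt (1 - r ^ 2) ≠ 0 :=
    (Real.sqrt_pos.2 (by nlinarith [hr.1, hr.2] : (0 : ℝ) < 1 - r ^ 2)).ne'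
  have hmem : frame r hr a F none ∈ cutoffSpace r hr a F := subset_span (Set.mem_range_self _)
  have h2 := (cutoffSpace r hr a F).smul_mem (Real.sqrt (1 - r ^ 2))⁻¹ hmem
  simp only [frame] at h2
  rwa [smul_smul, inv_mul_cancel₀ hc, one_smul] at h2

/-- PRINTED ACTION, shells kept: for `m ∈ F` the cut-off fixes `δ_m` — "`δ_m` for `-ω ≤ m < θ - k_v`"
in the display preceding (6.8). [cite: Frankenhuijsen2014, §6.3.2] -/
theorem starProjection_e_of_mem {m : ℤ} (hm : m ∈ F) :
    (cutoffSpace r hr a F).starProjection (e m) = e m :=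
  starProjection_eq_self_iff.2 (by
    have : frame r hr a F (some ⟨m, hm⟩) = e m := rfl
    rw [← this]
    exact subset_span (Set.mem_range_self _))

/-- PRINTED ACTION, shells cut away: for `m < a` outside `F` the cut-off kills `δ_m` — "`0` for
`m < -ω`" in the display preceding (6.8). [cite: Frankenhuijsen2014, §6.3.2] -/
theorem starProjection_e_of_lt_of_not_mem {m : ℤ} (hma : m < a) (hmF : m ∉ F) :
    (cutoffSpace r hr a F).starProjection (e m) = 0 := by
  classical
  have horth : e m ∈ (cutoffSpace r hr a F)ᗮ := by
    apply mem_orthogonal_span_range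
    rintro (_ | ⟨n, hn⟩)
    · simp only [frame, real_inner_smul_left]
      rw [inner_ballVec_e r hr a hma, mul_zero]
    · simp only [frame]
      rw [inner_e_left, e_apply, if_neg]
      rintro rfl
      exact hmF hn
  rw [starProjection_apply, orthogonalProjectionOnto_eq_zero_iff.2 horth, Submodule.coe_zero]

include hr in
/-- PRINTED ACTION, at and beyond the ball: for `m ≥ a` the cut-off maps `δ_m` to
`(1 - r²) r^{m-a} β_a` — "`Q √|·|_v 𝔭_v^{θ-k_v}` with `Q = q_v^{θ-k_v-m/2}(1 - q_v^{-1})` for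
`m ≥ θ - k_v`" in the display preceding (6.8) (`r = q_v^{-1/2}`, `a = θ - k_v`,
`√|·|_v 𝔭_v^{a} = (n ↦ q_v^{-n/2}, n ≥ a) = r^{a} β_a`). [cite: Frankenhuijsen2014, §6.3.2] -/
theorem starProjection_e_of_le (hF : ∀ n ∈ F, n < a) {m : ℤ} (ham : a ≤ m) :
    (cutoffSpace r hr a F).starProjection (e m) = ((1 - r ^ 2) * r ^ (m - a).toNat) • ballVec r hr a := by
  classical
  have hr2 : (0 : ℝ) < 1 - r ^ 2 := by nlinarith [hr.1, hr.2]
  apply eq_starProjection_of_mem_orthogonal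
  · exact (cutoffSpace r hr a F).smul_mem _ (ballVec_mem_cutoffSpace r hr a F)
  · apply mem_orthogonal_span_range
    rintro (_ | ⟨n, hn⟩)
    · simp only [frame, real_inner_smul_left]
      rw [inner_sub_right, real_inner_smul_right, real_inner_comm (e m), inner_e_left, ballVec_apply,
        ballFun, if_pos ham, inner_ballVec_self r hr a]
      field_simp
      ring
    · simp only [frame]
      rw [inner_sub_right, real_inner_smul_right, inner_e_ballVec r hr a (hF n hn), mul_zero, sub_zero,
        inner_e_left, e_apply, if_neg]
      have := hF n hn
      omega

end PrintedAction

/-! ## 6. Van Frankenhuijsen's window `-ω ≤ m < θ - k_v` and the statements (6.8)–(6.10) as printed -/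

section VFWindow

variable (r : ℝ) (hr : 0 ≤ r ∧ r < 1) (ω θ k : ℤ)

/-- The shells kept by van Frankenhuijsen's cut-off `E_v C_{𝓕_v θ} A_v M_Ω`: `-ω ≤ m < θ - k_v`
(the ball sits at `θ - k_v`). [cite: Frankenhuijsen2014, §6.3.2] -/
abbrev vfShells (ω θ k : ℤ) : Finset ℤ := Finset.Ico (-ω) (θ - k)

/-- The RANGE of van Frankenhuijsen's cut-off `P = E_v C_{𝓕_v θ} A_v M_Ω` (an orthogonal projection,
§6.4) on the space of degrees `ℓ²(K_v^*/𝔬_v^*) = ℓ²(ℤ)`: shells `-ω ≤ m < θ - k_v` and the ball vector at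
`θ - k_v`, with `r = q_v^{-1/2}`. [cite: Frankenhuijsen2014, §6.3.2 and §6.4] -/
abbrev vfCutoffSpace : Submodule ℝ l2Z := cutoffSpace r hr (θ - k) (vfShells ω θ k)

/-- The shells of the window lie below the ball `θ - k_v`. [folklore] -/
private theorem vfShells_lt : ∀ n ∈ vfShells ω θ k, n < θ - k :=
  fun _ hn => (Finset.mem_Ico.1 hn).2

/-- Under (6.7) `ω + θ ≥ k_v` the window has `θ + ω - k_v` shells. [cite: Frankenhuijsen2014, §6.3 (6.7)] -/
theorem card_vfShells (h67 : k ≤ ω + θ) : ((vfShells ω θ k).card : ℝ) = θ + ω - k := by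
  have h0 : (((θ - k - -ω).toNat : ℕ) : ℤ) = θ + ω - k := by
    rw [Int.toNat_of_nonneg (by omega)]; ring
  have h1 : ((((θ - k - -ω).toNat : ℕ) : ℤ) : ℝ) = ((θ + ω - k : ℤ) : ℝ) := congrArg Int.cast h0
  rw [Int.card_Ico, ← Int.cast_natCast, h1]
  push_cast
  ring

/-- **(6.8)** `tr(E_v C_{𝓕_v θ} A_v M_Ω U(a)) = min{|a|_v^{1/2}, |a|_v^{-1/2}} = q_v^{-|l|/2}` for
`a = π_v^l ∉ 𝔬_v^*`. [cite: Frankenhuijsen2014, §6.3.2 (6.8)] -/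
theorem trace_vfCutoff_shift_of_ne_zero {l : ℤ} (hl : l ≠ 0) :
    LinearMap.trace ℝ _ (compression (vfCutoffSpace r hr ω θ k) (shift l)) = r ^ l.natAbs := by
  rw [trace_compression_shift_cutoffSpace r hr _ _ (vfShells_lt ω θ k), if_neg hl, zero_add]

/-- **(6.9)** `tr(E_v C_{𝓕_v θ} A_v M_Ω U(a)) = θ + ω - k_v + 1` for `a ∈ 𝔬_v^*`, under (6.7).
[cite: Frankenhuijsen2014, §6.3.2 (6.9)] -/
theorem trace_vfCutoff_shift_zero (h67 : k ≤ ω + θ) :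
    LinearMap.trace ℝ _ (compression (vfCutoffSpace r hr ω θ k) (shift 0)) = θ + ω - k + 1 := by
  rw [trace_compression_shift_cutoffSpace r hr _ _ (vfShells_lt ω θ k), if_pos rfl, Int.natAbs_zero,
    pow_zero, card_vfShells ω θ k h67]

/-- The rank of the cut-off is `θ + ω - k_v + 1`, under (6.7). [cite: Frankenhuijsen2014, §6.3.2 (6.9)] -/
theorem finrank_vfCutoffSpace (h67 : k ≤ ω + θ) :
    (Module.finrank ℝ (vfCutoffSpace r hr ω θ k) : ℝ) = θ + ω - k + 1 := by
  rw [finrank_cutoffSpace r hr _ _ (vfShells_lt ω θ k), card_vfShells ω θ k h67]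

/-- **(6.10) as printed:** `tr(E_v C_{𝓕_v θ} A_v M_Ω U_h) = (θ + ω + 1 - k_v) h(1) + W_v(h)`, under (6.7),
for every finitely supported test function `h` on `K_v^*/𝔬_v^*` (`h 0 = h(1)` its value at the identity)
— the Lefschetz-type trace of the cut-off shift reproduces the local Weil term of the explicit formula
(4.6) identically. [cite: Frankenhuijsen2014, §6.3.2 (6.10)] -/
theorem trace_vfCutoff_combinedShift (h67 : k ≤ ω + θ) (h : ℤ →₀ ℝ) :
    LinearMap.trace ℝ _ (compression (vfCutoffSpace r hr ω θ k) (combinedShift h)) =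
      (θ + ω + 1 - k) * h 0 + weilLocalTerm r h := by
  rw [trace_compression_combinedShift_cutoffSpace r hr _ _ (vfShells_lt ω θ k), card_vfShells ω θ k h67]
  ring

/-- Printed action, first case: `E_v C_{𝓕_v θ} A_v M_Ω δ_m = 0` for `m < -ω` (§6.3.2), under (6.7).
[cite: Frankenhuijsen2014, §6.3.2] -/
theorem starProjection_vfCutoff_e_of_lt (h67 : k ≤ ω + θ) {m : ℤ} (hm : m < -ω) :
    (vfCutoffSpace r hr ω θ k).starProjection (e m) = 0 :=
  starProjection_e_of_lt_of_not_mem r hr _ _ (by omega) (by simp [Finset.mem_Ico]; omega)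

/-- Printed action, second case: `E_v C_{𝓕_v θ} A_v M_Ω δ_m = δ_m` for `-ω ≤ m < θ - k_v` (§6.3.2).
[cite: Frankenhuijsen2014, §6.3.2] -/
theorem starProjection_vfCutoff_e_of_mem {m : ℤ} (h1 : -ω ≤ m) (h2 : m < θ - k) :
    (vfCutoffSpace r hr ω θ k).starProjection (e m) = e m :=
  starProjection_e_of_mem r hr _ _ (Finset.mem_Ico.2 ⟨h1, h2⟩)

/-- Printed action, third case: `E_v C_{𝓕_v θ} A_v M_Ω δ_m = Q √|·|_v 𝔭_v^{θ-k_v}`,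
`Q = q_v^{θ-k_v-m/2}(1 - q_v^{-1})`, for `m ≥ θ - k_v` (§6.3.2), i.e. `(1 - r²) r^{m-(θ-k_v)} β_{θ-k_v}`.
[cite: Frankenhuijsen2014, §6.3.2] -/
theorem starProjection_vfCutoff_e_of_le {m : ℤ} (hm : θ - k ≤ m) :
    (vfCutoffSpace r hr ω θ k).starProjection (e m) =
      ((1 - r ^ 2) * r ^ (m - (θ - k)).toNat) • ballVec r hr (θ - k) :=
  starProjection_e_of_le r hr _ _ (vfShells_lt ω θ k) hm

end VFWindow

/-! ## 7. Dictionary with the modulus -/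

/-- For `s = q_v^{1/2} ≥ 1` and `|a|_v = q_v^{-l}`: `min{|a|_v^{1/2}, |a|_v^{-1/2}} = min{s^{-l}, s^{l}}
= (s⁻¹)^{|l|} = r^{|l|}` — the right-hand side of (6.8) in the variable `r = q_v^{-1/2}` used above.
[cite: Frankenhuijsen2014, §6.3.2 (6.8)] -/
theorem min_zpow_neg_zpow_eq {s : ℝ} (hs : 1 ≤ s) (l : ℤ) :
    min (s ^ (-l)) (s ^ l) = s⁻¹ ^ l.natAbs := by
  have hle : ∀ n : ℕ, (s ^ n)⁻¹ ≤ s ^ n := fun n =>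
    (inv_le_one_of_one_le₀ (one_le_pow₀ hs)).trans (one_le_pow₀ hs)
  obtain ⟨n, rfl | rfl⟩ := Int.eq_nat_or_neg l
  · rw [Int.natAbs_natCast, zpow_neg, zpow_natCast, inv_pow]
    exact min_eq_left (hle n)
  · rw [neg_neg, Int.natAbs_neg, Int.natAbs_natCast, zpow_neg, zpow_natCast, inv_pow]
    exact min_eq_right (hle n)

end LocalCutoff

end Literature.NumberTheory.ConnesConsani
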